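import Mathlib.RepresentationTheory.Homological.GroupCohomology.Functoriality
import Mathlib.RepresentationTheory.Homological.GroupCohomology.LongExactSequence
import Mathlib.Algebra.Group.Subgroup.Pointwise
import Mathlib.AlgebraicTopology.FundamentalGroupoid.FundamentalGroup
import Literature.AlgebraicGeometry.Motives.LocalSystems
import HarnessLib

/-!
# Locally trivial extension classes in `H¹` of a monodromy group

Topic `Literature/AlgebraicGeometry/HodgeTheory` (definition request `defn-LocallyTrivialExtensionClasses`,
routes LinearSystemTorelli / NodalSupport of the Hodge summit). The vocabulary of
C. Schnell, *Primitive cohomology and the tube mapping*, Math. Z. 268 (2010) §1, §3 [Schnell2010] and of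
P. Brosnan, H. Fang, Z. Nie, G. Pearlstein, *Singularities of admissible normal functions*, Invent.
Math. 177 (2009) §1 [BrosnanFangNiePearlstein2009], in three layers, all REAL definitions on top of
Mathlib's group cohomology (`groupCohomology.H1`, `groupCohomology.map`) and the tree's local systems
(`Motives.LocalSystem`, `LocalSystem.monodromyRep`):

* **Group cohomology** (`A : Rep k G`). `H1res A S : H¹(G, A) ⟶ H¹(S, A)` is the restriction to a
  subgroup and `H1resKer A S` its kernel (`H1resKer_mk_iff`: a cocycle `φ` restricts to zero iff
  `φ|_S` is a coboundary; antitone in `S`, `⊤ ↦ ⊥`, `⊥ ↦ ⊤`, invariant under conjugating `S` —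
  `H1resKer_conj_smul` — so that "a subgroup well defined up to conjugacy" has a well-defined kernel);
  `locallyTrivialOfSubgroups A 𝔖 = ⨅_{S ∈ 𝔖} H1resKer A S`. Schnell's *third map*
  `evalCoinv A : H¹(G, A) → ∏_{g ∈ G} A ⧸ (g - 1)A`, `[φ] ↦ (φ g)_g` ([Schnell2010] §3, the map
  (restr-M): the product of the restrictions to the cyclic subgroups `⟨g⟩`, `H¹(⟨g⟩, A) ≅ A/(g-1)A`),
  and its version `evalCoinvOn A S` on a subgroup (the map of the route's "local Schnell theorem").
  The **extension class** `extensionClass f hf : invariantsMod f →ₗ H¹(G, W)` of a vector `e` of a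
  representation `E` that is invariant modulo an injective sub-object `f : W ⟶ E`: the class of the
  cocycle `g ↦ f⁻¹(g·e - e)`; it kills `f(W)` and is Mathlib's connecting homomorphism
  `δ⁰ : H⁰(G, E/W) → H¹(G, W)` (`extensionClass_eq_δ`); `extensionClassMap f hf j hj hex` is the induced
  map on `range j ≅ E ⧸ ker j` for an invariant `j : E → T` with `ker j ≤ f(W)`.
* **Topology** (`ι : C(S, T)` a continuous map — intended: the inclusion `(P ∖ Δ)(ℂ) ↪ P(ℂ)` of the
  complex points of a discriminant complement — a local system `V` of `k`-modules on `S`, a base point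
  `s`). `loopSubgroup W x` is the subgroup of `π₁(S, x)` of classes of loops staying in `W ⊆ S`
  (= the image of `π₁(W, x) → π₁(S, x)`); `localSubgroup ι s N hs' γ ≤ π₁(S, s)` is the LOCAL
  SUBGROUP at a subset `N ⊆ T` seen from `s' ∈ ι⁻¹ N` and transported to `s` along a path `γ`
  (for `N` a small ball around `t₀ ∈ Δ` this is the local fundamental group `G_{t₀}` of the route,
  [Schnell2010] §9 / Milnor's conic structure; well defined up to conjugacy, whence `H1resKer_conj_smul`).
  `monodromyRepObj V s : Rep k (π₁(S, s))` is the monodromy representation on the fibre `V_s`.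
* **The notion.** `trivialNear ι V s F` (for a filter `F` on `T`) is the subspace of classes
  `ξ ∈ H¹(π₁(S, s), V_s)` that restrict to zero on the local subgroups of SOME member `N ∈ F`
  (`mem_trivialNear_iff`; the union is directed); `localKernel ι V s t₀ = trivialNear ι V s (𝓝 t₀)`
  is the kernel of "restriction to the local fundamental group at `t₀`", in the colimit-over-
  neighbourhoods form of [BrosnanFangNiePearlstein2009] §1 eq. (1)
  (`σ_s(ν) ∈ colim_{U ∋ s} H¹(U ∩ S, 𝕍)`), which needs no conic-structure theorem to be well defined;
  and `locallyTrivialClasses ι V s D = ⨅_{t₀ ∈ D} localKernel ι V s t₀` is the space **LocTriv** of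
  LOCALLY TRIVIAL CLASSES along `D ⊆ T` (route LinearSystemTorelli: `D = Δ(ℂ)`,
  `LocTriv = ker (H¹(G, V_s) → ∏_{t₀ ∈ Δ} H¹(G_{t₀}, V_s))`).

## The dictionary with the hyperplane-section family (how the routes instantiate this file)

For `X ⊂ ℙ^N` smooth projective of dimension `d`, `P` the dual projective space, `Δ = X^∨` the
discriminant, `P^sm = P ∖ Δ`, `G = π₁(P^sm(ℂ), s)` acting on `V_s = H^{d-1}(X_s, ℚ)_van`
([Schnell2010] §1 pp. 2–4): take `S = P^sm(ℂ)`, `T = P(ℂ)`, `ι` the inclusion, `V` the vanishing local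
system (definition request `HyperplaneSectionLocalSystem`), `D = Δ(ℂ)`. Schnell's *first* and *second*
maps `H^d(X, ℚ)_prim → H¹(P^sm, 𝕍) ≅ H¹(G, V_s)` ([Schnell2010] §3 (step1), Lemma 2 and (step2)) are,
up to the sign conventions of the Leray spectral sequence, the extension class of the local system of
pairs `t ↦ H^d(X, X_t)`: with `E = H^d(X(ℂ), X_s(ℂ))`, `W = V_s`, `f = ∂^* : V_s ↪ H^d(X, X_s)` and
`j : H^d(X, X_s) → H^d(X)` (so `range j = H^d(X)_prim = ker (H^d(X) → H^d(X_s))`, `ker j = f(V_s)` over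
`ℚ` by [Schnell2010] §1 (decompS)), the class map is `c = extensionClassMap f hf j hj hex`, and
`c(ω)(g) = g·ω̃ - ω̃` for a lift `ω̃ ∈ H^d(X, X_s)` is the "tube period cocycle": paired with a
`g`-invariant `α ∈ H_{d-1}(X_s)` it is the period of `ω` over the tube class `τ_g(α)` ([Schnell2010]
§8, identity (identity-g) `∫_{τ_g(α)} ω = ∫_α λ_g(ω)`). This is also the topological class
`cl(ν_ω) ∈ H¹(S, 𝕍)` of the normal function of a primitive Hodge class ([BrosnanFangNiePearlstein2009]
§1, the connecting homomorphism `cl_ℤ`), whose image in `colim_U H¹(U ∩ S, 𝕍)` is the singularity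
`σ_s(ν)` (loc. cit. eq. (1)) — here: `c(ω) ∉ localKernel … t₀` iff `ν_ω` is singular at `t₀`.

## Mathlib / tree search

Mathlib has `groupCohomology.H1`, `H1π`, `H1_induction_on`, `groupCohomology.map` (restriction is
`map S.subtype (𝟙 _) 1`, cf. `groupCohomology.H1InfRes`), the connecting homomorphism
`groupCohomology.δ` with `δ₀_apply`, `FundamentalGroup.fundamentalGroupMulEquivOfPath`; it has no
restriction-kernel / local-subgroup / locally-trivial vocabulary (searched `H1InfRes`, `resNatTrans`,
`localSubgroup`, `LocalSystem`: nothing beyond the above). The tree has `Motives.LocalSystem` with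
`monodromyRep` (used here through `Rep.of`).

## Deliberately NOT here

* Tube classes `τ_g(α) ∈ H_d(X, ℚ)/i_* H_d(X_s)` themselves ([Schnell2010] §1 p. 4): they need
  chain-level parallel transport in the `C^∞` family; by (identity-g) they are the adjoints of
  `ω ↦ evalCoinv _ (c ω) g` under the intersection pairings, so `c` and `evalCoinv` carry the same
  information (Schnell's dual formulation, §3 (tube-dual)).
* The second presentation `LocTriv ≅ H¹(P(ℂ), j_* 𝕍)` (Leray for `j : P^sm ↪ P`): no sheaf cohomology of
  local systems on `P(ℂ)` in the tree.
* The hyperplane-section package itself (schemes `P ⊃ Δ`, the family, the vanishing local system) —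
  the separate request `HyperplaneSectionLocalSystem`; everything here is stated for an arbitrary
  continuous `ι : S → T`, local system `V` and base point `s`, and for arbitrary `Rep`s.
* No named facts: Schnell's Theorem 1 / Proposition 7 and BFNP Cor. 46 are separate cite items.

## References

* [Schnell2010] C. Schnell, Primitive cohomology and the tube mapping, Math. Z. 268 (2010) 1069–1089
  (= arXiv:0711.3927), §1, §3 (step1)–(step3), Lemma 2, §8 Lemma 13 and (identity-g).
* [BrosnanFangNiePearlstein2009] P. Brosnan, H. Fang, Z. Nie, G. Pearlstein, Singularities of
  admissible normal functions, Invent. Math. 177 (2009) (= arXiv:0711.0964), §1 eq. (1).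
* [HatcherAT2002] A. Hatcher, Algebraic Topology (2002), §1.1 (change of base point, Prop. 1.5;
  induced homomorphisms).
-/

noncomputable section

open CategoryTheory groupCohomology ShortComplex
open scoped Pointwise

universe u v

namespace Literature.AlgebraicGeometry.HodgeTheory

/-! ### Restriction kernels in `H¹` -/

section GroupCohomology

variable {k G : Type u} [CommRing k] [Group G] (A : Rep k G)

/-- The **restriction map** `res : H¹(G, A) ⟶ H¹(S, A|_S)` to a subgroup `S ≤ G` (Mathlib's
`groupCohomology.map S.subtype (𝟙 _) 1`, as in `groupCohomology.H1InfRes`); on cocycles it is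
`φ ↦ φ ∘ S.subtype`. [cite: Schnell2010, §3 (the third map)] -/
abbrev H1res (S : Subgroup G) : H1 A ⟶ H1 (Rep.res S.subtype A) :=
  groupCohomology.map S.subtype (𝟙 (Rep.res S.subtype A)) 1

/-- The **restriction kernel** `ker (res : H¹(G, A) → H¹(S, A))` of a subgroup `S ≤ G`: the classes
that become trivial on `S`. For `S = G_{t₀}` a local fundamental group this is "locally trivial at
`t₀`". [cite: Schnell2010, §3 (the third map)] -/
def H1resKer (S : Subgroup G) : Submodule k (H1 A) :=
  LinearMap.ker (H1res A S).hom

/-- Membership in the `1`-coboundaries, unfolded: `f ∈ B¹(G, B)` iff `f g = g·x - x` for some `x`.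
[folklore] -/
theorem mem_coboundaries₁_iff_exists (B : Rep k G) (f : G → B.V) :
    f ∈ coboundaries₁ B ↔ ∃ x : B.V, ∀ g, B.ρ g x - x = f g := by
  constructor
  · rintro ⟨x, hx⟩
    exact ⟨x, fun g => by rw [← hx]; rfl⟩
  · rintro ⟨x, hx⟩
    exact ⟨x, funext fun g => by rw [← hx g]; rfl⟩

variable {A} in
/-- The class of a `1`-cocycle `φ` restricts to zero on `S` iff `φ|_S` is a coboundary: there is
`x ∈ A` with `φ g = g·x - x` for all `g ∈ S` (explicit description of `H¹ = Z¹/B¹`).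
[cite: Schnell2010, §3 (the second map, Z¹ and B¹)] -/
theorem H1resKer_mk_iff (S : Subgroup G) (φ : cocycles₁ A) :
    H1π A φ ∈ H1resKer A S ↔ ∃ x : A.V, ∀ g ∈ S, A.ρ g x - x = φ g := by
  rw [H1resKer, LinearMap.mem_ker]
  change (H1π A ≫ groupCohomology.map S.subtype (𝟙 _) 1) φ = 0 ↔ _
  rw [H1π_comp_map, ModuleCat.comp_apply, H1π_eq_zero_iff, coe_mapCocycles₁,
    mem_coboundaries₁_iff_exists]
  constructor
  · rintro ⟨x, hx⟩
    exact ⟨x, fun g hg => by simpa using hx ⟨g, hg⟩⟩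
  · rintro ⟨x, hx⟩
    exact ⟨x, fun g => by simpa using hx g g.2⟩

/-- Restriction kernels are antitone in the subgroup: `S ≤ T → ker res_T ≤ ker res_S` (restriction
to `S` factors through restriction to `T`). [folklore] -/
theorem H1resKer_antitone : Antitone (H1resKer A) := by
  intro S T hST ξ hξ
  induction ξ using H1_induction_on with
  | h φ =>
    obtain ⟨x, hx⟩ := (H1resKer_mk_iff T φ).1 hξ
    exact (H1resKer_mk_iff S φ).2 ⟨x, fun g hg => hx g (hST hg)⟩

/-- Every class restricts to zero on the trivial subgroup (`H¹(1, A) = 0`). [folklore] -/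
theorem H1resKer_bot : H1resKer A ⊥ = ⊤ := by
  refine eq_top_iff.2 fun ξ _ => ?_
  induction ξ using H1_induction_on with
  | h φ =>
    refine (H1resKer_mk_iff ⊥ φ).2 ⟨0, fun g hg => ?_⟩
    rw [Subgroup.mem_bot] at hg
    subst hg
    simp

/-- Only the zero class restricts to zero on all of `G` (non-vacuity of the notion). [folklore] -/
theorem H1resKer_top : H1resKer A ⊤ = ⊥ := by
  refine eq_bot_iff.2 fun ξ hξ => ?_
  induction ξ using H1_induction_on with
  | h φ =>
    obtain ⟨x, hx⟩ := (H1resKer_mk_iff ⊤ φ).1 hξ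
    rw [Submodule.mem_bot, H1π_eq_zero_iff, mem_coboundaries₁_iff_exists]
    exact ⟨x, fun g => hx g (Subgroup.mem_top g)⟩

/-- **Conjugation invariance.** `ker res_{hSh⁻¹} = ker res_S`: inner automorphisms act trivially on
`H¹(G, A)` (if `φ|_S` is the coboundary of `x` then `φ|_{hSh⁻¹}` is the coboundary of `h·x - φ h`).
Hence the restriction kernel of a subgroup given only up to conjugacy — such as a local fundamental
group, which depends on a path to the base point — is well defined. [cite: HatcherAT2002, §1.1 Prop. 1.5] -/
theorem H1resKer_conj_smul (S : Subgroup G) (h : G) :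
    H1resKer A (MulAut.conj h • S) = H1resKer A S := by
  suffices key : ∀ (T : Subgroup G) (h : G), H1resKer A T ≤ H1resKer A (MulAut.conj h • T) by
    refine le_antisymm ?_ (key S h)
    have := key (MulAut.conj h • S) h⁻¹
    rwa [map_inv, inv_smul_smul] at this
  intro T h ξ hξ
  induction ξ using H1_induction_on with
  | h φ =>
    obtain ⟨x, hx⟩ := (H1resKer_mk_iff T φ).1 hξ
    refine (H1resKer_mk_iff _ φ).2 ⟨A.ρ h x - φ h, fun g hg => ?_⟩
    rw [Subgroup.mem_pointwise_smul_iff_inv_smul_mem, ← map_inv, MulAut.smul_def,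
      MulAut.conj_apply, inv_inv] at hg
    have hc := (mem_cocycles₁_iff (A := A) φ).1 φ.2
    have r1 : ∀ y, A.ρ (g * h) (A.ρ h⁻¹ y) = A.ρ g y := fun y => by
      rw [← Module.End.mul_apply, ← map_mul, mul_assoc, mul_inv_cancel, mul_one]
    have r2 : ∀ y, A.ρ h (A.ρ (h⁻¹ * g * h) y) = A.ρ g (A.ρ h y) := fun y => by
      rw [← Module.End.mul_apply, ← map_mul, ← Module.End.mul_apply, ← map_mul]
      congr 2
      group
    have c1 : φ g = φ (g * h * h⁻¹) := by rw [mul_inv_cancel_right]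
    have c2 : φ (g * h) = φ (h * (h⁻¹ * g * h)) := by congr 1; group
    have c3 := cocycles₁_map_inv φ h⁻¹
    rw [inv_inv] at c3
    have c4 : φ h⁻¹ = -(A.ρ h⁻¹ (φ h)) := neg_eq_iff_eq_neg.1 c3.symm
    rw [c1, hc, c4, map_neg, r1, c2, hc, ← hx _ hg]
    simp only [map_sub, r2]
    abel

/-- The classes **locally trivial with respect to a family `𝔖` of subgroups**:
`⨅_{S ∈ 𝔖} ker (res : H¹(G, A) → H¹(S, A))`. With `𝔖` the local fundamental groups at the points
of a discriminant this is the route's `LocTriv`; see `locallyTrivialClasses` for the topological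
version. [cite: BrosnanFangNiePearlstein2009, §1 eq. (1)] -/
def locallyTrivialOfSubgroups (𝔖 : Set (Subgroup G)) : Submodule k (H1 A) :=
  ⨅ S ∈ 𝔖, H1resKer A S

/-- Membership in `locallyTrivialOfSubgroups`, unfolded. [folklore] -/
theorem mem_locallyTrivialOfSubgroups_iff (𝔖 : Set (Subgroup G)) (ξ : H1 A) :
    ξ ∈ locallyTrivialOfSubgroups A 𝔖 ↔ ∀ S ∈ 𝔖, ξ ∈ H1resKer A S := by
  simp [locallyTrivialOfSubgroups]

/-- `locallyTrivialOfSubgroups` is antitone in the family of subgroups. [folklore] -/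
theorem locallyTrivialOfSubgroups_antitone : Antitone (locallyTrivialOfSubgroups A) :=
  fun _ _ h => biInf_mono h

/-! ### Schnell's third map `H¹(G, A) → ∏_g A/(g - 1)A` -/

/-- The submodule `(g - 1)A = range (ρ(g) - id)` of `A`. [cite: Schnell2010, §3 (the third map)] -/
abbrev subOneRange (g : G) : Submodule k A.V :=
  LinearMap.range (A.ρ g - LinearMap.id)

/-- Evaluation of `1`-cocycles modulo `(g - 1)A`: `φ ↦ (φ g + (g - 1)A)_{g ∈ G}`.
[cite: Schnell2010, §3 (the third map, eq. (restr-M))] -/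
def evalCoinvCocycles : cocycles₁ A →ₗ[k] ((g : G) → A.V ⧸ subOneRange A g) :=
  LinearMap.pi fun g => (subOneRange A g).mkQ ∘ₗ LinearMap.proj g ∘ₗ (cocycles₁ A).subtype

/-- `evalCoinvCocycles` unfolded. [folklore] -/
theorem evalCoinvCocycles_apply (φ : cocycles₁ A) (g : G) :
    evalCoinvCocycles A φ g = (subOneRange A g).mkQ (φ g) := rfl

/-- Coboundaries `g ↦ g·x - x` evaluate to zero modulo `(g - 1)A`. [cite: Schnell2010, §3 (the third map)] -/
theorem evalCoinvCocycles_d₀₁ (x : A.V) :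
    evalCoinvCocycles A ⟨d₀₁ A x, d₀₁_apply_mem_cocycles₁ x⟩ = 0 := by
  funext g
  rw [evalCoinvCocycles_apply, Pi.zero_apply, Submodule.mkQ_apply, Submodule.Quotient.mk_eq_zero]
  exact ⟨x, by simp [d₀₁]⟩

/-- **Schnell's third map** as a morphism `H¹(G, A) ⟶ ∏_{g ∈ G} A/(g - 1)A` in `ModuleCat`,
`[φ] ↦ (φ g + (g - 1)A)_g`: the product over `g` of the restrictions to the cyclic subgroups `⟨g⟩`
followed by `H¹(⟨g⟩, A) ≅ A/(g - 1)A` (descended from `evalCoinvCocycles` through `H1Iso`).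
[cite: Schnell2010, §3 (the third map, eq. (restr-M))] -/
def evalCoinvHom : H1 A ⟶ ModuleCat.of k ((g : G) → A.V ⧸ subOneRange A g) :=
  (H1Iso A).hom ≫ (shortComplexH1 A).moduleCatLeftHomologyData.descH
    (ModuleCat.ofHom (evalCoinvCocycles A)) (by
      ext x : 2
      change evalCoinvCocycles A ⟨d₀₁ A x, _⟩ = 0
      exact evalCoinvCocycles_d₀₁ A x)

/-- **Schnell's third map** `H¹(G, A) →ₗ ∏_{g ∈ G} A/(g - 1)A`, `[φ] ↦ (φ g + (g - 1)A)_g`. Not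
injective for general `A` ([Schnell2010] §7 example), injective for the vanishing cohomology
(loc. cit. Props. 8, 10 — not stated here). [cite: Schnell2010, §3 (the third map, eq. (restr-M))] -/
def evalCoinv : H1 A →ₗ[k] ((g : G) → A.V ⧸ subOneRange A g) :=
  (evalCoinvHom A).hom

/-- `evalCoinvHom` is the descent of `evalCoinvCocycles` along `H1π`. [folklore] -/
theorem H1π_comp_evalCoinvHom :
    H1π A ≫ evalCoinvHom A = ModuleCat.ofHom (evalCoinvCocycles A) := by
  rw [evalCoinvHom, H1π, Category.assoc, π_comp_H1Iso_hom_assoc, Iso.inv_hom_id_assoc]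
  erw [LeftHomologyData.π_descH]
  rfl

/-- The computation rule: `evalCoinv [φ] g = φ g mod (g - 1)A`.
[cite: Schnell2010, §3 (the third map, eq. (restr-M))] -/
theorem evalCoinv_H1π (φ : cocycles₁ A) (g : G) :
    evalCoinv A (H1π A φ) g = (subOneRange A g).mkQ (φ g) :=
  congrArg (fun f : ModuleCat.of k (cocycles₁ A) ⟶ _ =>
    (f.hom φ : (g : G) → A.V ⧸ subOneRange A g) g) (H1π_comp_evalCoinvHom A)

/-- Schnell's third map **on a subgroup** `S ≤ G`: `H¹(G, A) → H¹(S, A) → ∏_{g ∈ S} A/(g - 1)A`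
(restriction followed by `evalCoinv` of `A|_S`). For `S = G_{t₀}` a local fundamental group this is
the map of the route's "local Schnell theorem" (LocalTubeSpan). [cite: Schnell2010, §3 (the third map, eq. (restr-M))] -/
def evalCoinvOn (S : Subgroup G) : H1 A →ₗ[k] ((g : S) → A.V ⧸ subOneRange A (g : G)) :=
  evalCoinv (Rep.res S.subtype A) ∘ₗ (H1res A S).hom

/-- The computation rule on a subgroup: `evalCoinvOn S [φ] g = φ g mod (g - 1)A` for `g ∈ S`.
[cite: Schnell2010, §3 (the third map, eq. (restr-M))] -/
theorem evalCoinvOn_H1π (S : Subgroup G) (φ : cocycles₁ A) (g : S) :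
    evalCoinvOn A S (H1π A φ) g = (subOneRange A (g : G)).mkQ (φ g) := by
  rw [evalCoinvOn, LinearMap.comp_apply]
  change evalCoinv _ ((H1π A ≫ groupCohomology.map S.subtype (𝟙 _) 1) φ) g = _
  rw [H1π_comp_map, ModuleCat.comp_apply, evalCoinv_H1π]
  rfl

/-- The restriction kernel of `S` dies under `evalCoinvOn S`. [folklore] -/
theorem H1resKer_le_ker_evalCoinvOn (S : Subgroup G) :
    H1resKer A S ≤ LinearMap.ker (evalCoinvOn A S) := fun ξ hξ => by
  rw [LinearMap.mem_ker, evalCoinvOn, LinearMap.comp_apply, LinearMap.mem_ker.1 hξ, map_zero]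

/-! ### Extension classes (the connecting homomorphism `H⁰(G, E/W) → H¹(G, W)`) -/

variable {A}
variable {W E : Rep k G} (f : W ⟶ E) (hf : Function.Injective f.hom)

/-- The vectors of `E` that are **invariant modulo `f(W)`**: `g·e - e ∈ f(W)` for all `g ∈ G`
(the preimage of the invariants of `E/f(W)`). [folklore] -/
def invariantsMod : Submodule k E.V :=
  ⨅ g : G, (LinearMap.range f.hom.toLinearMap).comap (E.ρ g - LinearMap.id)

/-- Membership in `invariantsMod`, unfolded. [folklore] -/
theorem mem_invariantsMod_iff (e : E.V) :
    e ∈ invariantsMod f ↔ ∀ g : G, E.ρ g e - e ∈ LinearMap.range f.hom.toLinearMap := by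
  simp [invariantsMod]

/-- The cochain `g ↦ f⁻¹(g·e - e) : G → W` of a vector `e` invariant modulo the injective `f(W)`.
[cite: Schnell2010, §8 (identity-g)] -/
def extensionCochain (e : invariantsMod f) : G → W.V := fun g =>
  (LinearEquiv.ofInjective f.hom.toLinearMap hf).symm
    ⟨E.ρ g e - e, (mem_invariantsMod_iff f e).1 e.2 g⟩

/-- Defining property of `extensionCochain`: `f (extensionCochain e g) = g·e - e`. [folklore] -/
theorem f_extensionCochain (e : invariantsMod f) (g : G) :
    f.hom (extensionCochain f hf e g) = E.ρ g e - e :=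
  LinearEquiv.ofInjective_symm_apply (f := f.hom.toLinearMap) (h := hf) _

/-- `g ↦ f⁻¹(g·e - e)` is a `1`-cocycle (`(gh)e - e = g(he - e) + (ge - e)` and `f` is an
injective `G`-map). [folklore] -/
theorem extensionCochain_mem_cocycles₁ (e : invariantsMod f) :
    extensionCochain f hf e ∈ cocycles₁ W := by
  rw [mem_cocycles₁_iff]
  intro g h
  apply hf
  rw [map_add, f_extensionCochain, f_extensionCochain, Rep.hom_comm_apply, f_extensionCochain,
    map_mul, Module.End.mul_apply, map_sub]
  abel

/-- The **extension cocycle** `g ↦ f⁻¹(g·e - e) ∈ Z¹(G, W)` of `e ∈ invariantsMod f`. In the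
hyperplane-section dictionary (`E = H^d(X, X_s)`, `W = V_s`, `e` a lift of a primitive class `ω`)
this is the tube-period cocycle `g ↦ λ_g(ω)`. [cite: Schnell2010, §8 (identity-g)] -/
def extensionCocycle (e : invariantsMod f) : cocycles₁ W :=
  ⟨extensionCochain f hf e, extensionCochain_mem_cocycles₁ f hf e⟩

/-- Defining property of `extensionCocycle`: `f (extensionCocycle e g) = g·e - e`. [folklore] -/
theorem extensionCocycle_apply (e : invariantsMod f) (g : G) :
    f.hom (extensionCocycle f hf e g) = E.ρ g e - e :=
  f_extensionCochain f hf e g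

/-- `e ↦ extensionCocycle e` is `k`-linear. [folklore] -/
def extensionCocycleₗ : invariantsMod f →ₗ[k] cocycles₁ W where
  toFun := extensionCocycle f hf
  map_add' e e' := by
    refine cocycles₁_ext fun g => hf ?_
    change f.hom _ = f.hom ((extensionCocycle f hf e : G → W.V) g +
      (extensionCocycle f hf e' : G → W.V) g)
    rw [map_add, extensionCocycle_apply, extensionCocycle_apply, extensionCocycle_apply]
    simp only [Submodule.coe_add, map_add]
    abel
  map_smul' c e := by
    refine cocycles₁_ext fun g => hf ?_
    change f.hom _ = f.hom (c • (extensionCocycle f hf e : G → W.V) g)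
    rw [map_smul, extensionCocycle_apply, extensionCocycle_apply]
    simp only [Submodule.coe_smul, map_smul, smul_sub]

/-- The **extension class** `invariantsMod f →ₗ H¹(G, W)`, `e ↦ [g ↦ f⁻¹(g·e - e)]`: the class in
`Ext¹_G(k, W) = H¹(G, W)` of the extension `0 → W → W + k·e → k → 0`. For the local systems
`0 → 𝕍 → ℰ_ν → ℤ → 0` underlying a normal function this is its class `cl(ν) ∈ H¹(S, 𝕍)`
([BrosnanFangNiePearlstein2009] §1), and for the pair `(X, X_s)` of the hyperplane-section family it
is Schnell's map `H^d(X)_prim → H¹(G, V_s)` (module docstring). [cite: BrosnanFangNiePearlstein2009, §1 (cl_ℤ)] -/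
def extensionClass : invariantsMod f →ₗ[k] H1 W :=
  (H1π W).hom ∘ₗ extensionCocycleₗ f hf

/-- `extensionClass` unfolded. [folklore] -/
theorem extensionClass_apply (e : invariantsMod f) :
    extensionClass f hf e = H1π W (extensionCocycle f hf e) := rfl

/-- The extension class **vanishes on `f(W)`**: for `e = f w` the cocycle is the coboundary of `w`.
[folklore] -/
theorem extensionClass_eq_zero_of_mem_range (e : invariantsMod f)
    (he : (e : E.V) ∈ LinearMap.range f.hom.toLinearMap) : extensionClass f hf e = 0 := by
  obtain ⟨w, hw⟩ := he
  rw [extensionClass_apply, H1π_eq_zero_iff]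
  refine ⟨w, funext fun g => hf ?_⟩
  change f.hom (d₀₁ W w g) = f.hom (extensionCocycle f hf e g)
  rw [extensionCocycle_apply, d₀₁_hom_apply, map_sub, Rep.hom_comm_apply]
  change E.ρ g (f.hom.toLinearMap w) - f.hom.toLinearMap w = _
  rw [hw]

/-- **Compatibility with Mathlib's connecting homomorphism.** For a short exact sequence
`0 → X₁ → X₂ → X₃ → 0` of representations and `e ∈ X₂` with invariant image `z = g(e) ∈ X₃^G`,
the extension class of `e` is `δ⁰(z)` (`groupCohomology.δ₀_apply`). [folklore] -/
theorem extensionClass_eq_δ {X : ShortComplex (Rep k G)} (hX : X.ShortExact)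
    (e : invariantsMod X.f) (z : X.X₃.ρ.invariants) (hz : X.g.hom e = z) :
    extensionClass X.f ((Rep.mono_iff_injective X.f).1 hX.mono_f) e =
      δ hX 0 1 rfl ((H0Iso X.X₃).inv z) := by
  have hx : X.f.hom ∘ (extensionCocycle X.f ((Rep.mono_iff_injective X.f).1 hX.mono_f) e) =
      d₀₁ X.X₂ e := funext fun g => by
    rw [Function.comp_apply, d₀₁_hom_apply]
    exact extensionCocycle_apply X.f _ e g
  rw [extensionClass_apply, δ₀_apply hX z e hz _ hx]
  rfl

variable {T : Type v} [AddCommGroup T] [Module k T] (j : E.V →ₗ[k] T)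

/-- If `j : E → T` is `G`-invariant with `ker j ≤ f(W)` then every vector of `E` is invariant modulo
`f(W)` (`g·e - e ∈ ker j`). [folklore] -/
theorem invariantsMod_eq_top (hj : ∀ (g : G) (e : E.V), j (E.ρ g e) = j e)
    (hex : LinearMap.ker j ≤ LinearMap.range f.hom.toLinearMap) : invariantsMod f = ⊤ := by
  refine eq_top_iff.2 fun e _ => (mem_invariantsMod_iff f e).2 fun g => hex ?_
  rw [LinearMap.mem_ker, map_sub, hj, sub_self]

/-- The inclusion `E → invariantsMod f` under the hypotheses of `invariantsMod_eq_top`. [folklore] -/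
def toInvariantsMod (hj : ∀ (g : G) (e : E.V), j (E.ρ g e) = j e)
    (hex : LinearMap.ker j ≤ LinearMap.range f.hom.toLinearMap) : E.V →ₗ[k] invariantsMod f :=
  LinearMap.codRestrict _ LinearMap.id fun e => by
    rw [invariantsMod_eq_top f j hj hex]; trivial

/-- `extensionClass ∘ toInvariantsMod` kills `ker j` (because `ker j ≤ f(W)`). [folklore] -/
theorem ker_le_ker_extensionClass_comp (hj : ∀ (g : G) (e : E.V), j (E.ρ g e) = j e)
    (hex : LinearMap.ker j ≤ LinearMap.range f.hom.toLinearMap) :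
    LinearMap.ker j ≤ LinearMap.ker (extensionClass f hf ∘ₗ toInvariantsMod f j hj hex) :=
  fun e he => by
    rw [LinearMap.mem_ker, LinearMap.comp_apply]
    exact extensionClass_eq_zero_of_mem_range f hf _ (hex he)

/-- The **extension class map** on `range j ≅ E ⧸ ker j` for a `G`-invariant `j : E → T` with
`ker j ≤ f(W)`: `j(e) ↦ [g ↦ f⁻¹(g·e - e)] ∈ H¹(G, W)`, independent of the lift `e`. Dictionary:
`E = H^d(X, X_s)`, `f : V_s ↪ E`, `j : E → H^d(X)` with `range j = H^d(X)_prim`; then this is the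
class map `c : H^d(X, ℚ)_prim → H¹(G, V_s)` of [Schnell2010] §3 (step1)–(step2) (up to the sign
conventions of the Leray spectral sequence) whose values are the tube periods (loc. cit. §8
(identity-g)). [cite: Schnell2010, §3 eq. (step1)–(step2) and §8 (identity-g)] -/
def extensionClassMap (hj : ∀ (g : G) (e : E.V), j (E.ρ g e) = j e)
    (hex : LinearMap.ker j ≤ LinearMap.range f.hom.toLinearMap) :
    LinearMap.range j →ₗ[k] H1 W :=
  (LinearMap.ker j).liftQ (extensionClass f hf ∘ₗ toInvariantsMod f j hj hex)
      (ker_le_ker_extensionClass_comp f hf j hj hex) ∘ₗ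
    (LinearMap.quotKerEquivRange j).symm.toLinearMap

/-- The computation rule: on `j e` the extension class map is the class of `g ↦ f⁻¹(g·e - e)`.
[cite: Schnell2010, §8 (identity-g)] -/
theorem extensionClassMap_apply (hj : ∀ (g : G) (e : E.V), j (E.ρ g e) = j e)
    (hex : LinearMap.ker j ≤ LinearMap.range f.hom.toLinearMap) (e : E.V) :
    extensionClassMap f hf j hj hex ⟨j e, LinearMap.mem_range_self j e⟩ =
      H1π W (extensionCocycle f hf (toInvariantsMod f j hj hex e)) := by
  rw [extensionClassMap, LinearMap.comp_apply, LinearEquiv.coe_toLinearMap,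
    LinearMap.quotKerEquivRange_symm_apply_image j e (LinearMap.mem_range_self j e),
    Submodule.mkQ_apply, Submodule.liftQ_apply]
  rfl

end GroupCohomology

/-! ### Loops in a subset and local subgroups -/

section Loops

variable {S : Type u} [TopologicalSpace S]

/-- The subgroup of `π₁(S, x)` of classes represented by **loops staying in `W ⊆ S`** (`x ∈ W`):
the standard description of the image of `π₁(W, x) → π₁(S, x)`, written without the subspace
topology (the comparison with Mathlib's `FundamentalGroup.map` of the inclusion is not needed and not
proved here). [cite: HatcherAT2002, §1.1 (induced homomorphisms)] -/
def loopSubgroup (W : Set S) (x : S) (hx : x ∈ W) : Subgroup (FundamentalGroup S x) where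
  carrier := {p | ∃ δ : Path x x, Set.range δ ⊆ W ∧
    FundamentalGroup.fromPath (Path.Homotopic.Quotient.mk δ) = p}
  one_mem' := ⟨Path.refl x, by simpa using hx, by
    rw [FundamentalGroup.one_def, ← Path.Homotopic.Quotient.mk_refl]⟩
  mul_mem' := by
    rintro _ _ ⟨δ₁, h₁, rfl⟩ ⟨δ₂, h₂, rfl⟩
    refine ⟨δ₂.trans δ₁, ?_, ?_⟩
    · rw [Path.trans_range]; exact Set.union_subset h₂ h₁
    · rw [FundamentalGroup.mul_def, Path.Homotopic.Quotient.mk_trans]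
  inv_mem' := by
    rintro _ ⟨δ, h, rfl⟩
    refine ⟨δ.symm, by rwa [Path.symm_range], ?_⟩
    rw [FundamentalGroup.inv_def, Path.Homotopic.Quotient.mk_symm]

/-- Membership in `loopSubgroup`, unfolded. [folklore] -/
theorem mem_loopSubgroup_iff {W : Set S} {x : S} (hx : x ∈ W) (p : FundamentalGroup S x) :
    p ∈ loopSubgroup W x hx ↔ ∃ δ : Path x x, Set.range δ ⊆ W ∧
      FundamentalGroup.fromPath (Path.Homotopic.Quotient.mk δ) = p := Iff.rfl

/-- `loopSubgroup` is monotone in the subset. [folklore] -/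
theorem loopSubgroup_mono {W W' : Set S} (h : W ⊆ W') {x : S} (hx : x ∈ W) :
    loopSubgroup W x hx ≤ loopSubgroup W' x (h hx) := by
  rintro _ ⟨δ, hδ, rfl⟩
  exact ⟨δ, hδ.trans h, rfl⟩

/-- Every class is represented by a loop in `S` itself. [folklore] -/
theorem loopSubgroup_univ (x : S) : loopSubgroup Set.univ x (Set.mem_univ x) = ⊤ := by
  refine eq_top_iff.2 fun p _ => ?_
  induction p using Quotient.ind with
  | _ δ => exact ⟨δ, Set.subset_univ _, rfl⟩

variable {T : Type v} [TopologicalSpace T] (ι : C(S, T)) (s : S)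

/-- The **local subgroup** of `π₁(S, s)` at a subset `N ⊆ T`, seen from a point `s'` with
`ι s' ∈ N` and transported to the base point along a path `γ` from `s'` to `s`: the conjugate by `γ`
of the classes of loops at `s'` staying in `ι⁻¹ N`. For `ι : (P ∖ Δ)(ℂ) ↪ P(ℂ)` and `N` a small ball
around `t₀ ∈ Δ(ℂ)` this is the local fundamental group `G_{t₀} = im (π₁(B ∖ Δ) → π₁(P ∖ Δ))`, well
defined up to conjugacy (change of `s'`, `γ`). [cite: HatcherAT2002, §1.1 Prop. 1.5] -/
def localSubgroup (N : Set T) {s' : S} (hs' : ι s' ∈ N) (γ : Path s' s) :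
    Subgroup (FundamentalGroup S s) :=
  (loopSubgroup (ι ⁻¹' N) s' hs').map
    (FundamentalGroup.fundamentalGroupMulEquivOfPath γ).toMonoidHom

/-- Local subgroups are monotone in `N`. [folklore] -/
theorem localSubgroup_mono {N N' : Set T} (h : N ⊆ N') {s' : S} (hs' : ι s' ∈ N)
    (γ : Path s' s) : localSubgroup ι s N hs' γ ≤ localSubgroup ι s N' (h hs') γ :=
  Subgroup.map_mono (loopSubgroup_mono (Set.preimage_mono (f := ι) h) hs')

end Loops

/-! ### The notion: local kernels and locally trivial classes -/

section LocallyTrivial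

open _root_.Topology Filter

variable {k S : Type u} [CommRing k] [TopologicalSpace S] {T : Type v} [TopologicalSpace T]
  (ι : C(S, T)) (V : Motives.LocalSystem k S) (s : S)

/-- The **monodromy representation** of the local system `V` on its fibre `V_s`, as an object of
`Rep k (π₁(S, s))` (the tree's `LocalSystem.monodromyRep` through `Rep.of`); its `H¹` is
`groupCohomology.H1 (monodromyRepObj V s) = H¹(π₁(S, s), V_s)`, which for reasonable connected `S` is
`H¹(S, V)` ([Schnell2010] Lemma 2). [cite: Schnell2010, §3 Lemma 2 and eq. (step2)] -/
abbrev monodromyRepObj : Rep k (FundamentalGroup S s) :=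
  Rep.of (V.monodromyRep s)

/-- The classes of `H¹(π₁(S, s), V_s)` that restrict to zero on every local subgroup at the subset
`N ⊆ T` (all view points `s'` with `ι s' ∈ N` and all paths `γ` to the base point; when `ι⁻¹ N` is
path connected all these local subgroups are conjugate, so by `H1resKer_conj_smul` one pair suffices
— not formalised here). [cite: BrosnanFangNiePearlstein2009, §1 eq. (1)] -/
def localKernelOn (N : Set T) : Submodule k (H1 (monodromyRepObj V s)) :=
  ⨅ (s' : S) (hs' : ι s' ∈ N) (γ : Path s' s), H1resKer (monodromyRepObj V s) (localSubgroup ι s N hs' γ)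

/-- Membership in `localKernelOn`, unfolded. [folklore] -/
theorem mem_localKernelOn_iff (N : Set T) (ξ : H1 (monodromyRepObj V s)) :
    ξ ∈ localKernelOn ι V s N ↔ ∀ (s' : S) (hs' : ι s' ∈ N) (γ : Path s' s),
      ξ ∈ H1resKer (monodromyRepObj V s) (localSubgroup ι s N hs' γ) := by
  simp only [localKernelOn, Submodule.mem_iInf]

/-- `localKernelOn` is antitone in `N` (smaller pieces have smaller local subgroups, hence larger
restriction kernels). [folklore] -/
theorem localKernelOn_antitone : Antitone (localKernelOn ι V s) := by
  intro N N' h ξ hξ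
  rw [mem_localKernelOn_iff] at hξ ⊢
  intro s' hs' γ
  exact H1resKer_antitone _ (localSubgroup_mono ι s h hs' γ) (hξ s' (h hs') γ)

/-- The classes **trivial near a filter `F` on `T`**: `⨆_{N ∈ F} localKernelOn N`, i.e. (the union
being directed, `mem_trivialNear_iff`) those restricting to zero on the local subgroups of SOME
`N ∈ F`. For `F = 𝓝 t₀` see `localKernel`; `F = 𝓝ˢ Z` gives triviality near a subset.
[cite: BrosnanFangNiePearlstein2009, §1 eq. (1)] -/
def trivialNear (F : Filter T) : Submodule k (H1 (monodromyRepObj V s)) :=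
  ⨆ N ∈ F, localKernelOn ι V s N

/-- **Directedness**: a class is trivial near `F` iff it restricts to zero on the local subgroups of
one member of `F` (the kernel of the map to the colimit `colim_{N ∈ F}` is the union of the kernels).
[cite: BrosnanFangNiePearlstein2009, §1 eq. (1)] -/
theorem mem_trivialNear_iff (F : Filter T) (ξ : H1 (monodromyRepObj V s)) :
    ξ ∈ trivialNear ι V s F ↔ ∃ N ∈ F, ξ ∈ localKernelOn ι V s N := by
  constructor
  · intro h
    rw [trivialNear, iSup_subtype'] at h
    haveI : Nonempty {N // N ∈ F} := ⟨⟨Set.univ, Filter.univ_mem⟩⟩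
    have hdir : Directed (· ≤ ·) fun N : {N // N ∈ F} => localKernelOn ι V s N.1 := by
      intro N₁ N₂
      refine ⟨⟨N₁.1 ∩ N₂.1, Filter.inter_mem N₁.2 N₂.2⟩, ?_, ?_⟩
      · exact localKernelOn_antitone ι V s Set.inter_subset_left
      · exact localKernelOn_antitone ι V s Set.inter_subset_right
    obtain ⟨N, hN⟩ := (Submodule.mem_iSup_of_directed _ hdir).1 h
    exact ⟨N.1, N.2, hN⟩
  · rintro ⟨N, hN, h⟩
    exact Submodule.mem_iSup_of_mem N (Submodule.mem_iSup_of_mem hN h)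

/-- `trivialNear` is antitone in the filter (a finer filter has more members). [folklore] -/
theorem trivialNear_mono {F F' : Filter T} (h : F ≤ F') : trivialNear ι V s F' ≤ trivialNear ι V s F :=
  fun ξ hξ => by
    obtain ⟨N, hN, hξN⟩ := (mem_trivialNear_iff ι V s F' ξ).1 hξ
    exact (mem_trivialNear_iff ι V s F ξ).2 ⟨N, h hN, hξN⟩

/-- The **local kernel at `t₀ ∈ T`**: the classes `ξ ∈ H¹(π₁(S, s), V_s)` restricting to zero on the
local subgroups of some neighbourhood of `t₀` — equivalently of all sufficiently small ones
(`localKernelOn_antitone`), i.e. `ker (H¹(G, V_s) → H¹(G_{t₀}, V_s))` for the local fundamental group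
`G_{t₀}` of any small ball when these stabilise (Milnor's conic structure), and the kernel of
`H¹(S, 𝕍) → colim_{U ∋ t₀} H¹(U ∩ S, 𝕍) = (R¹ j_* 𝕍)_{t₀}` in the sheaf language of
[BrosnanFangNiePearlstein2009] §1 eq. (1) (where the image of `cl(ν)` is the singularity `σ_{t₀}(ν)`).
At points away from the closure of `ι(S)` it is everything (`localKernel_eq_top_of_not_mem_closure`).
[cite: BrosnanFangNiePearlstein2009, §1 eq. (1)] -/
def localKernel (t₀ : T) : Submodule k (H1 (monodromyRepObj V s)) :=
  trivialNear ι V s (𝓝 t₀)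

/-- Membership in the local kernel: some neighbourhood of `t₀` all of whose local subgroups kill `ξ`.
[cite: BrosnanFangNiePearlstein2009, §1 eq. (1)] -/
theorem mem_localKernel_iff (t₀ : T) (ξ : H1 (monodromyRepObj V s)) :
    ξ ∈ localKernel ι V s t₀ ↔ ∃ N ∈ 𝓝 t₀, ∀ (s' : S) (hs' : ι s' ∈ N) (γ : Path s' s),
      ξ ∈ H1resKer (monodromyRepObj V s) (localSubgroup ι s N hs' γ) := by
  simp only [localKernel, mem_trivialNear_iff, mem_localKernelOn_iff]

/-- Away from the closure of `ι(S)` the local kernel is everything (there is nothing to restrict to).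
[folklore] -/
theorem localKernel_eq_top_of_not_mem_closure {t₀ : T} (h : t₀ ∉ closure (Set.range ι)) :
    localKernel ι V s t₀ = ⊤ := by
  refine eq_top_iff.2 fun ξ _ => (mem_localKernel_iff ι V s t₀ ξ).2
    ⟨(closure (Set.range ι))ᶜ, isClosed_closure.isOpen_compl.mem_nhds h, fun s' hs' _ => ?_⟩
  exact absurd (subset_closure (Set.mem_range_self s')) hs'

/-- **Locally trivial classes along `D ⊆ T`** (`LocTriv`): the classes of `H¹(π₁(S, s), V_s)` lying in
the local kernel at every point of `D`, `⨅_{t₀ ∈ D} localKernel t₀`. For the hyperplane-section family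
(`S = (P ∖ Δ)(ℂ)`, `T = P(ℂ)`, `V` the vanishing local system, `D = Δ(ℂ)`) this is the route's
`LocTriv = ker (H¹(G, V_s) → ∏_{t₀ ∈ Δ} H¹(G_{t₀}, V_s))` — the part of `H¹` of the discriminant
complement group that no local fundamental group sees; classes `c(ω)` of primitive `ω` are locally
trivial at `t₀` iff the normal function of `ω` has no singularity at `t₀`
([BrosnanFangNiePearlstein2009] §1). [cite: BrosnanFangNiePearlstein2009, §1 eq. (1)] -/
def locallyTrivialClasses (D : Set T) : Submodule k (H1 (monodromyRepObj V s)) :=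
  ⨅ t₀ ∈ D, localKernel ι V s t₀

/-- Membership in `locallyTrivialClasses`, unfolded. [folklore] -/
theorem mem_locallyTrivialClasses_iff (D : Set T) (ξ : H1 (monodromyRepObj V s)) :
    ξ ∈ locallyTrivialClasses ι V s D ↔ ∀ t₀ ∈ D, ξ ∈ localKernel ι V s t₀ := by
  simp [locallyTrivialClasses]

/-- `locallyTrivialClasses` is antitone in `D`. [folklore] -/
theorem locallyTrivialClasses_antitone : Antitone (locallyTrivialClasses ι V s) :=
  fun _ _ h => biInf_mono h

/-- Only the points of `D` in the closure of `ι(S)` matter: `LocTriv(D) = LocTriv(D ∩ closure ι(S))`.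
[folklore] -/
theorem locallyTrivialClasses_inter_closure (D : Set T) :
    locallyTrivialClasses ι V s (D ∩ closure (Set.range ι)) = locallyTrivialClasses ι V s D := by
  refine le_antisymm (fun ξ hξ => ?_) (locallyTrivialClasses_antitone ι V s Set.inter_subset_left)
  rw [mem_locallyTrivialClasses_iff] at hξ ⊢
  intro t₀ ht₀
  by_cases h : t₀ ∈ closure (Set.range ι)
  · exact hξ t₀ ⟨ht₀, h⟩
  · rw [localKernel_eq_top_of_not_mem_closure ι V s h]
    trivial

end LocallyTrivial

end Literature.AlgebraicGeometry.HodgeTheory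

end
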